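import Summits.QuantumAdvantage.QuantumAdvantage.Theorems.SosSandwichPseudoBoundedAAClassicalCornerQuadraticLeaf
import HarnessLib

/-!
# Crux `PseudoBoundedAA` (stmt-QuantumAdvantage-15237, route SosSandwich) — the classical corner `R_T`:
# signed path sums of a decision tree and the O'Donnell–Servedio bound `Σₓ F·(Σᵢ σᵢ χᵢ) ≤ √(2^N Σₓ cost)`

Support file for the rank-2 crux PB-AA (`Theses/SosSandwich.lean`, item stmt-QuantumAdvantage-15237), classical corner
`R_T ⊆ K_T` (acceptance probabilities of randomized classical query algorithms; `ClassicalCorner`).  The tree holds on `R_T`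
the law `16·Var[p]² ≤ D̄²·maxⱼ Infⱼ[p]` (exponent `2` in the number of queries) and the leaf-martingale law with one factor `D̄`
but the maximum over coordinates inside the expectation (`ClassicalCornerQuadratic`); whether exponent `1` holds with the
maximum outside is the open calibration question of the previous hands.  This file and its sequel
(`SosSandwichPseudoBoundedAAClassicalCornerLevelOne`) answer it for the level-one part of the variance by porting the
O'Donnell–Servedio inequality `Σᵢ |f̂(i)| ≤ √(E #queries)` to the tree's decision trees.  Here: the per-tree statement.

* `sum_sgn_apply`, `sum_mul_sgn_eq_zero`, `linForm_update` — bookkeeping for the characters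
  `χᵢ(x) = sgn (x i)` (`true ↦ −1`, the tree's cube Fourier convention of `Literature/Probability/RandomGraphs/LowDegree`);
* `ovr_update_eq`, `ovr_eq_ovr_update` — inputs overridden by a partial assignment `ρ : Fin N → Option Bool`
  (`x ↦ (k ↦ (ρ k).getD (x k))`, the convention of `BooleanCorner.osss_depth_aux` / `ClassicalCornerQuadratic.exists_leafAvg`);
* **`exists_pathSum`** — for a tree `t` run under `ρ` and signs `|σᵢ| ≤ 1` there is `S` (the signed sum `Σ σᵢ χᵢ(x)` over the
  free coordinates queried on the path of `x`; `∃`-form, no definition enters the tree) with `Σₓ S = 0`, `S` ignoring the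
  assigned coordinates, `Σₓ S² ≤ Σₓ cost_t(x^ρ)` (orthogonality of the path increments: every queried bit is fresh) and
  `Σₓ F·(Σᵢ σᵢ χᵢ) = Σₓ F·S` for the `0/1` output `F` of `t` (a character not queried on a leaf subcube is orthogonal to it);
* **`sum_mul_linForm_le_sqrt_cost`** — `Σₓ F(x)·(Σᵢ σᵢ χᵢ(x)) ≤ √(2^N · Σₓ cost_t(x))`, i.e. `Σᵢ σᵢ F̂({i}) ≤ √(E_x cost_t(x))`
  (Cauchy–Schwarz on the previous line: `Σ F S ≤ Σ |S| ≤ √(2^N Σ S²)`).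

Honest label: a published inequality (O'Donnell–Servedio 2007) in the tree's decision-tree vocabulary; support for a
calibration of the classical corner of an open conjecture; no stub, crux or summit is closed.
Sources: R. O'Donnell, R. Servedio, *Learning monotone decision trees in polynomial time*, SIAM J. Comput. 37 (2007)
827–844, §3 (the bound `Σᵢ f̂(i) ≤ √(average depth)` via `E[(Σ_{queried} xᵢ)²] = E[#queries]`); R. O'Donnell, *Analysis of
Boolean Functions* (CUP 2014), §8.6, "OS Inequality": `Σᵢ f̂(i) ≤ ‖f‖₂ · √Δ(f)` (here at `p = 1/2`, per deterministic tree,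
with `‖F‖₂ ≤ 1` for the `0/1` leaf output).
-/

set_option linter.dupNamespace false

noncomputable section

namespace Summit.QuantumAdvantage.QuantumAdvantage.Theorems.SosSandwich

open Finset Function
open Literature.Computability.Complexity Literature.Computability.QuantumComplexity
open Literature.Probability.RandomGraphs.LowDegree (sgn sgn_true sgn_false)

namespace ClassicalCornerLevelOne

variable {N : ℕ}

/-! ### The characters `χᵢ(x) = sgn (x i)` -/

/-- `Σₓ χⱼ(x) = 0`. [folklore] -/
theorem sum_sgn_apply (j : Fin N) : ∑ x : Fin N → Bool, sgn (x j) = 0 := by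
  have h := BooleanCorner.sum_ite_update j (fun _ : Fin N → Bool => (-1 : ℝ)) (fun _ => (1 : ℝ))
    (fun _ _ => rfl) (fun _ _ => rfl)
  have hre : ∑ x : Fin N → Bool, sgn (x j)
      = ∑ x : Fin N → Bool, (if x j = true then (-1 : ℝ) else (1 : ℝ)) :=
    Finset.sum_congr rfl fun x _ => by unfold sgn; rfl
  rw [hre, h, Finset.sum_neg_distrib]
  ring

/-- `Σₓ ψ(x) χⱼ(x) = 0` when `ψ` ignores the coordinate `j`. [folklore] -/
theorem sum_mul_sgn_eq_zero (j : Fin N) (ψ : (Fin N → Bool) → ℝ) (hψ : ∀ x c, ψ (update x j c) = ψ x) :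
    ∑ x, ψ x * sgn (x j) = 0 := by
  have hre : ∀ x : Fin N → Bool, ψ x * sgn (x j) = if x j = true then -ψ x else ψ x := by
    intro x
    rcases Bool.eq_false_or_eq_true (x j) with hx | hx
    · rw [hx, if_pos rfl, sgn_true]; ring
    · rw [hx, if_neg Bool.false_ne_true, sgn_false]; ring
  rw [Finset.sum_congr rfl fun x _ => hre x,
    BooleanCorner.sum_ite_update j (fun x => -ψ x) ψ (fun x c => by rw [hψ]) hψ, Finset.sum_neg_distrib]
  ring

/-- Updating coordinate `j` changes the linear form `Σᵢ σᵢ χᵢ` only through its `j`-th term. [folklore] -/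
theorem linForm_update (σ : Fin N → ℝ) (x : Fin N → Bool) (j : Fin N) (c : Bool) :
    ∑ i, σ i * sgn (update x j c i) = ∑ i, σ i * sgn (x i) - σ j * sgn (x j) + σ j * sgn c := by
  have h1 := Finset.sum_erase_add (Finset.univ : Finset (Fin N)) (fun i => σ i * sgn (update x j c i))
    (Finset.mem_univ j)
  have h2 := Finset.sum_erase_add (Finset.univ : Finset (Fin N)) (fun i => σ i * sgn (x i)) (Finset.mem_univ j)
  have h3 : ∑ i ∈ Finset.univ.erase j, σ i * sgn (update x j c i) = ∑ i ∈ Finset.univ.erase j, σ i * sgn (x i) :=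
    Finset.sum_congr rfl fun i hi => by rw [update_of_ne (Finset.ne_of_mem_erase hi)]
  simp only [update_self] at h1
  linarith

/-! ### Inputs overridden by a partial assignment -/

/-- At a coordinate assigned by `ρ`, the overridden input ignores the input bit. [folklore] -/
theorem ovr_update_eq (ρ : Fin N → Option Bool) (j : Fin N) (hj : ρ j ≠ none) (x : Fin N → Bool) (d : Bool) :
    (fun k => (ρ k).getD (update x j d k)) = fun k => (ρ k).getD (x k) := by
  funext k
  by_cases hk : k = j
  · subst hk
    cases h : ρ k with
    | none => exact absurd h hj
    | some b => simp
  · rw [update_of_ne hk]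

/-- If `ρ` leaves `j` free and `x j = c`, overriding by `ρ` is overriding by `ρ[j ↦ c]`. [folklore] -/
theorem ovr_eq_ovr_update (ρ : Fin N → Option Bool) (j : Fin N) (hj : ρ j = none) (x : Fin N → Bool) (c : Bool)
    (hx : x j = c) :
    (fun k => (ρ k).getD (x k)) = fun k => (update ρ j (some c) k).getD (x k) := by
  funext k
  by_cases hk : k = j
  · subst hk
    simp [hj, hx]
  · rw [update_of_ne hk]

/-! ### The signed path sum (O'Donnell–Servedio), in `∃`-form -/

/-- **Signed path sums of a decision tree.**  Let the tree `t` be run on the input overridden by the partial assignment `ρ`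
(`x ↦ (k ↦ (ρ k).getD (x k))`) and let `|σᵢ| ≤ 1`.  Then there is `S` (the signed character sum
`Σ_{i queried on the path of x, i free in ρ} σᵢ χᵢ(x)`) with: (i) `Σₓ S = 0`; (ii) `S` ignores every coordinate assigned by
`ρ`; (iii) `Σₓ S² ≤ Σₓ cost_t(x^ρ)` — the increments along the path are orthogonal (each queried bit is fresh), so
`E S² = E #(free queried coordinates) ≤ E cost`; (iv) `Σₓ F·(Σᵢ σᵢ χᵢ) = Σₓ F·S` for the `0/1` output `F` of `t` — a character
`χᵢ` not queried on the leaf subcube of `x` is orthogonal to that leaf.  Induction on `t`.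
[cite: ODonnellServedio2007, §3] [cite: ODonnell2014, §8.6 (OS Inequality)] -/
theorem exists_pathSum (t : DecisionTree N) :
    ∀ (ρ : Fin N → Option Bool) (σ : Fin N → ℝ), (∀ i, |σ i| ≤ 1) →
      ∃ S : (Fin N → Bool) → ℝ,
        (∑ x, S x = 0) ∧
        (∀ i : Fin N, ρ i ≠ none → ∀ y c, S (update y i c) = S y) ∧
        (∑ x, S x ^ 2 ≤ ∑ x : Fin N → Bool, ((t.cost (fun k => (ρ k).getD (x k)) : ℕ) : ℝ)) ∧
        (∀ F : (Fin N → Bool) → ℝ,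
          (∀ x, F x = if t.eval (fun k => (ρ k).getD (x k)) = true then (1 : ℝ) else 0) →
          ∑ x, F x * (∑ i, σ i * sgn (x i)) = ∑ x, F x * S x) := by
  induction t with
  | leaf b =>
    intro ρ σ _
    refine ⟨fun _ => 0, by simp, fun _ _ _ _ => rfl, ?_, ?_⟩
    · simp
    · intro F hF
      have hc : ∀ x : Fin N → Bool, F x = (if b = true then (1 : ℝ) else 0) := fun x => by
        rw [hF x]; simp [DecisionTree.eval]
      simp only [hc, mul_zero, Finset.sum_const_zero]
      rw [← Finset.mul_sum, Finset.sum_comm]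
      have h0 : ∀ i : Fin N, ∑ x : Fin N → Bool, σ i * sgn (x i) = 0 := fun i => by
        rw [← Finset.mul_sum, sum_sgn_apply, mul_zero]
      rw [Finset.sum_congr rfl fun i _ => h0 i, Finset.sum_const_zero, mul_zero]
  | query j t₀ t₁ ih₀ ih₁ =>
    intro ρ σ hσ
    rcases hρ : ρ j with _ | b
    · /- fresh query at the root: split along `x j` -/
      obtain ⟨S₀, hS₀sum, hS₀ign, hS₀sq, hS₀F⟩ := ih₀ (update ρ j (some false)) σ hσ
      obtain ⟨S₁, hS₁sum, hS₁ign, hS₁sq, hS₁F⟩ := ih₁ (update ρ j (some true)) σ hσ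
      have hρ₀j : update ρ j (some false) j ≠ none := by simp
      have hρ₁j : update ρ j (some true) j ≠ none := by simp
      -- the two branch outputs and costs, as functions on the whole cube ignoring `x j`
      obtain ⟨F₀, hF₀⟩ : ∃ F₀ : (Fin N → Bool) → ℝ, ∀ x,
          F₀ x = if t₀.eval (fun k => (update ρ j (some false) k).getD (x k)) = true then (1 : ℝ) else 0 :=
        ⟨_, fun x => rfl⟩
      obtain ⟨F₁, hF₁⟩ : ∃ F₁ : (Fin N → Bool) → ℝ, ∀ x,
          F₁ x = if t₁.eval (fun k => (update ρ j (some true) k).getD (x k)) = true then (1 : ℝ) else 0 :=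
        ⟨_, fun x => rfl⟩
      obtain ⟨C₀, hC₀⟩ : ∃ C₀ : (Fin N → Bool) → ℝ, ∀ x,
          C₀ x = ((t₀.cost (fun k => (update ρ j (some false) k).getD (x k)) : ℕ) : ℝ) := ⟨_, fun x => rfl⟩
      obtain ⟨C₁, hC₁⟩ : ∃ C₁ : (Fin N → Bool) → ℝ, ∀ x,
          C₁ x = ((t₁.cost (fun k => (update ρ j (some true) k).getD (x k)) : ℕ) : ℝ) := ⟨_, fun x => rfl⟩
      have hF₀j : ∀ x d, F₀ (update x j d) = F₀ x := fun x d => by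
        rw [hF₀, hF₀, ovr_update_eq _ j hρ₀j x d]
      have hF₁j : ∀ x d, F₁ (update x j d) = F₁ x := fun x d => by
        rw [hF₁, hF₁, ovr_update_eq _ j hρ₁j x d]
      have hC₀j : ∀ x d, C₀ (update x j d) = C₀ x := fun x d => by
        rw [hC₀, hC₀, ovr_update_eq _ j hρ₀j x d]
      have hC₁j : ∀ x d, C₁ (update x j d) = C₁ x := fun x d => by
        rw [hC₁, hC₁, ovr_update_eq _ j hρ₁j x d]
      have hS₀j : ∀ y c, S₀ (update y j c) = S₀ y := hS₀ign j hρ₀j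
      have hS₁j : ∀ y c, S₁ (update y j c) = S₁ y := hS₁ign j hρ₁j
      have hS₀sq' : ∑ x, S₀ x ^ 2 ≤ ∑ x, C₀ x :=
        hS₀sq.trans (le_of_eq (Finset.sum_congr rfl fun x _ => (hC₀ x).symm))
      have hS₁sq' : ∑ x, S₁ x ^ 2 ≤ ∑ x, C₁ x :=
        hS₁sq.trans (le_of_eq (Finset.sum_congr rfl fun x _ => (hC₁ x).symm))
      -- the root reads the input bit `x j`
      have hroot : ∀ x : Fin N → Bool, (ρ j).getD (x j) = x j := fun x => by rw [hρ]; rfl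
      -- pointwise splitting of cost and output along `x j`
      have hcost : ∀ x : Fin N → Bool,
          (((DecisionTree.query j t₀ t₁).cost (fun k => (ρ k).getD (x k)) : ℕ) : ℝ)
            = (if x j = true then C₁ x else C₀ x) + 1 := by
        intro x
        rw [DecisionTree.cost_query, hroot x]
        rcases Bool.eq_false_or_eq_true (x j) with hx | hx
        · rw [hx, if_pos rfl, if_pos rfl, hC₁ x, ovr_eq_ovr_update ρ j hρ x true hx]
          push_cast
          ring
        · rw [hx, if_neg Bool.false_ne_true, if_neg Bool.false_ne_true, hC₀ x, ovr_eq_ovr_update ρ j hρ x false hx]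
          push_cast
          ring
      have heval : ∀ (F : (Fin N → Bool) → ℝ),
          (∀ x, F x = if (DecisionTree.query j t₀ t₁).eval (fun k => (ρ k).getD (x k)) = true then (1 : ℝ) else 0) →
          ∀ x, F x = if x j = true then F₁ x else F₀ x := by
        intro F hF x
        rw [hF x, DecisionTree.eval_query, hroot x]
        rcases Bool.eq_false_or_eq_true (x j) with hx | hx
        · rw [hx, if_pos rfl, if_pos rfl, hF₁ x, ovr_eq_ovr_update ρ j hρ x true hx]
        · rw [hx, if_neg Bool.false_ne_true, if_neg Bool.false_ne_true, hF₀ x, ovr_eq_ovr_update ρ j hρ x false hx]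
      refine ⟨fun x => σ j * sgn (x j) + (if x j = true then S₁ x else S₀ x), ?_, ?_, ?_, ?_⟩
      · -- (i) mean zero
        rw [Finset.sum_add_distrib, ← Finset.mul_sum, sum_sgn_apply, mul_zero, zero_add,
          BooleanCorner.sum_ite_update j S₁ S₀ hS₁j hS₀j, hS₁sum, hS₀sum]
        norm_num
      · -- (ii) `S` ignores the coordinates assigned by `ρ`
        intro i hi y c
        have hij : i ≠ j := fun h => hi (by rw [h]; exact hρ)
        have hρ₀i : update ρ j (some false) i ≠ none := by rw [update_of_ne hij]; exact hi
        have hρ₁i : update ρ j (some true) i ≠ none := by rw [update_of_ne hij]; exact hi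
        simp only [update_of_ne (Ne.symm hij), hS₁ign i hρ₁i, hS₀ign i hρ₀i]
      · -- (iii) second moment ≤ cost
        have hsq : ∀ x : Fin N → Bool,
            (σ j * sgn (x j) + (if x j = true then S₁ x else S₀ x)) ^ 2
              = σ j ^ 2 + 2 * σ j * (if x j = true then -S₁ x else S₀ x)
                + (if x j = true then S₁ x ^ 2 else S₀ x ^ 2) := by
          intro x
          rcases Bool.eq_false_or_eq_true (x j) with hx | hx
          · rw [hx, if_pos rfl, if_pos rfl, if_pos rfl, sgn_true]; ring
          · rw [hx, if_neg Bool.false_ne_true, if_neg Bool.false_ne_true, if_neg Bool.false_ne_true, sgn_false]; ring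
        have hM : ∑ x : Fin N → Bool, (if x j = true then -S₁ x else S₀ x) = 0 := by
          rw [BooleanCorner.sum_ite_update j (fun x => -S₁ x) S₀ (fun x c => by rw [hS₁j]) hS₀j,
            Finset.sum_neg_distrib, hS₁sum, hS₀sum]
          norm_num
        have hQ : ∑ x : Fin N → Bool, (if x j = true then S₁ x ^ 2 else S₀ x ^ 2)
            = ((∑ x, S₁ x ^ 2) + ∑ x, S₀ x ^ 2) / 2 :=
          BooleanCorner.sum_ite_update j (fun x => S₁ x ^ 2) (fun x => S₀ x ^ 2)
            (fun x c => by rw [hS₁j]) (fun x c => by rw [hS₀j])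
        have hlhs : ∑ x : Fin N → Bool, (σ j * sgn (x j) + (if x j = true then S₁ x else S₀ x)) ^ 2
            = (2 : ℝ) ^ N * σ j ^ 2 + ((∑ x, S₁ x ^ 2) + ∑ x, S₀ x ^ 2) / 2 := by
          rw [Finset.sum_congr rfl fun x _ => hsq x, Finset.sum_add_distrib, Finset.sum_add_distrib,
            ← Finset.mul_sum, hM, hQ, Finset.sum_const, Finset.card_univ, BooleanCorner.card_cube_nat, nsmul_eq_mul]
          push_cast
          ring
        have hrhs : ∑ x : Fin N → Bool, (((DecisionTree.query j t₀ t₁).cost (fun k => (ρ k).getD (x k)) : ℕ) : ℝ)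
            = ((∑ x, C₁ x) + ∑ x, C₀ x) / 2 + (2 : ℝ) ^ N := by
          rw [Finset.sum_congr rfl fun x _ => hcost x, Finset.sum_add_distrib,
            BooleanCorner.sum_ite_update j C₁ C₀ hC₁j hC₀j, Finset.sum_const, Finset.card_univ,
            BooleanCorner.card_cube_nat, nsmul_eq_mul]
          push_cast
          ring
        rw [hlhs, hrhs]
        have hσj : σ j ^ 2 ≤ 1 := (sq_le_one_iff_abs_le_one (σ j)).mpr (hσ j)
        have h2N : (0 : ℝ) ≤ (2 : ℝ) ^ N := by positivity
        have h1 : (2 : ℝ) ^ N * σ j ^ 2 ≤ (2 : ℝ) ^ N * 1 := mul_le_mul_of_nonneg_left hσj h2N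
        linarith
      · -- (iv) unqueried characters are orthogonal to the leaves
        intro F hF
        have hFx := heval F hF
        -- right-hand side
        have hR : ∀ x : Fin N → Bool,
            F x * (σ j * sgn (x j) + (if x j = true then S₁ x else S₀ x))
              = if x j = true then F₁ x * (S₁ x - σ j) else F₀ x * (S₀ x + σ j) := by
          intro x
          rw [hFx x]
          rcases Bool.eq_false_or_eq_true (x j) with hx | hx
          · rw [hx, if_pos rfl, if_pos rfl, if_pos rfl, sgn_true]; ring
          · rw [hx, if_neg Bool.false_ne_true, if_neg Bool.false_ne_true, if_neg Bool.false_ne_true, sgn_false]; ring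
        have hRsum : ∑ x, F x * (σ j * sgn (x j) + (if x j = true then S₁ x else S₀ x))
            = ((∑ x, F₁ x * (S₁ x - σ j)) + ∑ x, F₀ x * (S₀ x + σ j)) / 2 := by
          rw [Finset.sum_congr rfl fun x _ => hR x]
          exact BooleanCorner.sum_ite_update j (fun x => F₁ x * (S₁ x - σ j)) (fun x => F₀ x * (S₀ x + σ j))
            (fun x c => by rw [hF₁j, hS₁j]) (fun x c => by rw [hF₀j, hS₀j])
        have e1 : ∑ x, F₁ x * (S₁ x - σ j) = (∑ x, F₁ x * S₁ x) - σ j * ∑ x, F₁ x := by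
          rw [Finset.mul_sum, ← Finset.sum_sub_distrib]
          exact Finset.sum_congr rfl fun x _ => by ring
        have e0 : ∑ x, F₀ x * (S₀ x + σ j) = (∑ x, F₀ x * S₀ x) + σ j * ∑ x, F₀ x := by
          rw [Finset.mul_sum, ← Finset.sum_add_distrib]
          exact Finset.sum_congr rfl fun x _ => by ring
        -- left-hand side: average over the two `j`-sections
        have hup1 : ∀ x : Fin N → Bool, F (update x j true) * ∑ i, σ i * sgn (update x j true i)
            = F₁ x * ∑ i, σ i * sgn (x i) - σ j * (F₁ x * sgn (x j)) - σ j * F₁ x := by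
          intro x
          rw [hFx (update x j true), update_self, if_pos rfl, hF₁j x true, linForm_update, sgn_true]
          ring
        have hup0 : ∀ x : Fin N → Bool, F (update x j false) * ∑ i, σ i * sgn (update x j false i)
            = F₀ x * ∑ i, σ i * sgn (x i) - σ j * (F₀ x * sgn (x j)) + σ j * F₀ x := by
          intro x
          rw [hFx (update x j false), update_self, if_neg Bool.false_ne_true, hF₀j x false, linForm_update, sgn_false]
          ring
        have hL1 : ∑ x : Fin N → Bool, F (update x j true) * ∑ i, σ i * sgn (update x j true i)
            = (∑ x, F₁ x * S₁ x) - σ j * ∑ x, F₁ x := by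
          rw [Finset.sum_congr rfl fun x _ => hup1 x, Finset.sum_sub_distrib, Finset.sum_sub_distrib,
            ← Finset.mul_sum, ← Finset.mul_sum, sum_mul_sgn_eq_zero j F₁ hF₁j, mul_zero, sub_zero, hS₁F F₁ hF₁]
        have hL0 : ∑ x : Fin N → Bool, F (update x j false) * ∑ i, σ i * sgn (update x j false i)
            = (∑ x, F₀ x * S₀ x) + σ j * ∑ x, F₀ x := by
          rw [Finset.sum_congr rfl fun x _ => hup0 x, Finset.sum_add_distrib, Finset.sum_sub_distrib,
            ← Finset.mul_sum, ← Finset.mul_sum, sum_mul_sgn_eq_zero j F₀ hF₀j, mul_zero, sub_zero, hS₀F F₀ hF₀]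
        have hLsum := BooleanCorner.sum_eq_half_sum_update j (fun x => F x * ∑ i, σ i * sgn (x i))
        rw [hLsum, hRsum, hL1, hL0, e1, e0]
    · /- the root is assigned by `ρ`: the tree is its `b`-branch -/
      have hroot : ∀ x : Fin N → Bool, (ρ j).getD (x j) = b := fun x => by rw [hρ]; rfl
      rcases Bool.eq_false_or_eq_true b with hb | hb
      · obtain ⟨S, hSsum, hSign, hSsq, hSF⟩ := ih₁ ρ σ hσ
        refine ⟨S, hSsum, hSign, hSsq.trans (Finset.sum_le_sum fun x _ => ?_), fun F hF => hSF F fun x => ?_⟩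
        · rw [DecisionTree.cost_query, hroot x, hb, if_pos rfl]
          push_cast
          linarith
        · rw [hF x, DecisionTree.eval_query, hroot x, hb, if_pos rfl]
      · obtain ⟨S, hSsum, hSign, hSsq, hSF⟩ := ih₀ ρ σ hσ
        refine ⟨S, hSsum, hSign, hSsq.trans (Finset.sum_le_sum fun x _ => ?_), fun F hF => hSF F fun x => ?_⟩
        · rw [DecisionTree.cost_query, hroot x, hb, if_neg Bool.false_ne_true]
          push_cast
          linarith
        · rw [hF x, DecisionTree.eval_query, hroot x, hb, if_neg Bool.false_ne_true]

/-- **O'Donnell–Servedio, single tree, sum form.** For the `0/1` output `F` of a decision tree `t` and signs `|σᵢ| ≤ 1`: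
`Σₓ F(x) · (Σᵢ σᵢ χᵢ(x)) ≤ √(2^N · Σₓ cost_t(x))`, i.e. `Σᵢ σᵢ F̂({i}) ≤ √(E_x cost_t(x))`.
[cite: ODonnellServedio2007, §3] [cite: ODonnell2014, §8.6 (OS Inequality)] -/
theorem sum_mul_linForm_le_sqrt_cost (t : DecisionTree N) (σ : Fin N → ℝ) (hσ : ∀ i, |σ i| ≤ 1)
    (F : (Fin N → Bool) → ℝ) (hF : ∀ x, F x = if t.eval x = true then (1 : ℝ) else 0) :
    ∑ x, F x * (∑ i, σ i * sgn (x i)) ≤ Real.sqrt ((2 : ℝ) ^ N * ∑ x, (t.cost x : ℝ)) := by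
  obtain ⟨S, -, -, hSsq, hSF⟩ := exists_pathSum t (fun _ => none) σ hσ
  have hSsq' : ∑ x, S x ^ 2 ≤ ∑ x, (t.cost x : ℝ) := by simpa using hSsq
  have hSF' : ∑ x, F x * (∑ i, σ i * sgn (x i)) = ∑ x, F x * S x := hSF F fun x => hF x
  rw [hSF']
  have hFS : ∀ x, F x * S x ≤ |S x| := by
    intro x
    rw [hF x]
    split_ifs
    · rw [one_mul]; exact le_abs_self _
    · rw [zero_mul]; exact abs_nonneg _
  have hA : 0 ≤ ∑ x, |S x| := Finset.sum_nonneg fun _ _ => abs_nonneg _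
  have hcs := ClassicalCornerQuadratic.sq_sum_le_card_mul_sum_sq (fun x => |S x|)
  simp only [sq_abs] at hcs
  calc ∑ x, F x * S x ≤ ∑ x, |S x| := Finset.sum_le_sum fun x _ => hFS x
    _ = Real.sqrt ((∑ x, |S x|) ^ 2) := (Real.sqrt_sq hA).symm
    _ ≤ Real.sqrt ((2 : ℝ) ^ N * ∑ x, S x ^ 2) := Real.sqrt_le_sqrt hcs
    _ ≤ Real.sqrt ((2 : ℝ) ^ N * ∑ x, (t.cost x : ℝ)) :=
        Real.sqrt_le_sqrt (mul_le_mul_of_nonneg_left hSsq' (by positivity))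

end ClassicalCornerLevelOne

end Summit.QuantumAdvantage.QuantumAdvantage.Theorems.SosSandwich

end
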